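import Summits.QuantumFields.YangMills.Theorems.UnitScaleTiltProp7PinnedRegaugeChartDiagonal
import Literature.MathematicalPhysics.QuantumFieldTheory.Balaban1983to89.B9Eq39Adjoint
import Literature.MathematicalPhysics.QuantumFieldTheory.Balaban1983to89.BlockAveragingExpMeanLog
import Mathlib.Algebra.Order.Chebyshev
import HarnessLib

/-!
# Prop 7 pinned re-gauge chart — the divergence row of (P-bch) in the covariant lattice letters (pointwise and ℓ², operator norm)

Route-R E′, path (α′), gap (P-bch-div) of `stmt-QuantumFields-19200` (crux `MinimiserStabilityRegPr`), cell ym3-torus, width seat px15.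

THE STEP.  In the letters of ✓ `B9Eq39Adjoint` (`T : ι → Equiv.Perm S` the shifts, `U : ι → S → (M_N(ℂ))ˣ` the background, `R(U)X = UXU⁻¹`,
`(D*_μ G)(x) = R(U_μ(x − e_μ))⁻¹G(x − e_μ) − G(x)`, `(D*A)(x) = Σ_μ (D*_μA_μ)(x)`), the chart remainder of ✓p653615∕✓p658500 is the bond field
`R₂(μ, x) = Φ♯(u(x), E_μ(x), δ_μ(x))`, `Φ♯(u, E, δ) := log(u·E·e^{−log u + δ}) − (log E + δ)`, with `u : S → SU(N)` the gauge corrector (DATA),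
`E_μ(x) = Y_{(x,μ)} + 1` the ratio field and `δ_μ(x) = log u(x) − W_μ(x)(log u(x+e_μ))W_μ(x)* = −(D_{U,μ} log u)(x)` the covariant difference of the
gauge letter (`U = W` read in the units).  Because `Φ♯` is conjugation-EQUIVARIANT (§1) and `D*_μ` compares CONSECUTIVE COLLINEAR bonds transported by
`U_μ(x − e_μ)` itself, the divergence of `R₂` at `x` is a sum over `μ` of differences `Φ♯(a′) − Φ♯(a)` whose slot differences are exactly the door's
covariant differences `D*_μ u`, `D*_μ E_μ`, `D*_μ δ_μ` at `x`; ✓ C¹-Φ♯ (`Prop7PinnedRegaugeChartDiagonal.norm_chartRemainderDiag_sub_le`) then gives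
the pointwise row (§3) and Cauchy–Schwarz the ℓ² row (§4).  No axial gauge and no smallness of `W` is needed.

WHAT IS PROVED (def-free; sup rows `‖u(x) − 1‖ ≤ σ`, `‖E_μ(x) − 1‖ ≤ τ`, `‖δ_μ(x)‖ ≤ ρ`, `σ, τ, ρ ≤ 1∕256`; `δ` is free data of that size).
* §1 `chartRemainderDiag_R` — `R(g)Φ♯(u, E, δ) = Φ♯(R(g)u, R(g)E, R(g)δ)` for every unit `g` (✓ `ExpMeanLog.mlog_conj`, `Matrix.exp_units_conj`).
* §2 `R_inv_eq_star_mul` (`R(U_μ(y))⁻¹X = W_μ(y)*·X·W_μ(y)` when `↑U = ↑W`, `W` `SU(N)`-valued), `neg_covD_mlog_eq` (`δ_μ = −D_{U,μ}(log u)`),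
  `covDstar_coe_eq` (the transported corrector `W*u(y)W ∈ SU(N)` realises `D*_μ u`).
* §3 ★★★ `norm_divB_chartRemainder_le` (POINTWISE DIVERGENCE ROW):
  `‖(D* R₂)(x)‖ ≤ Σ_μ [20(τ+ρ)·‖(D*_μ u)(x)‖ + 50(σ+ρ)·‖(D*_μ E_μ)(x)‖ + 10(σ+τ)·‖(D*_μ δ_μ)(x)‖]`.
* §4 ★★ `sum_norm_divB_chartRemainder_sq_le` (ℓ² ROW, operator norm): `Σ_x ‖(D* R₂)(x)‖² ≤ 3·|ι|·Σ_x Σ_μ [(20(τ+ρ))²‖D*_μ u‖² + (50(σ+ρ))²‖D*_μ E_μ‖²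
  + (10(σ+τ))²‖D*_μ δ_μ‖²](x)`.
PARTNERS (why this books ℓ-uniformly downstream): `τ + ρ ≍ (s‴ + σ₁)ℓ⁻¹` multiplies the corrector's first differences; `σ ≍ σ₀` multiplies only
`D*E` (first differences of `Y`, Weitzenböck on `D‴`) and `D*δ` (SECOND differences of `ψ`, Weitzenböck on `D_Wψ`).
HONEST SCOPE.  Operator-norm rows; the HS re-lettering (`‖·‖_op ≤ ‖·‖_HS ≤ √N‖·‖_op`), the re-indexing `Σ_x‖D*_μG(x)‖² = Σ_x‖D_μG(x)‖²`, the two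
Weitzenböck bookings and the corrector's equation (`DIV_W(D_Wψ)`) are the knit's, not here.  Constants ours; nothing of the cited papers is asserted.

References: T. Bałaban, CMP 98 (1985) 17–51 [Balaban1985Averaging] ((31) p.22); CMP 102 (1985) 277–309 [Balaban1985Variational] ((135) p.298,
(141)–(143) p.299); CMP 99 (1985) 389–434 [Balaban1985BackgroundPropagators] ((3.3)–(3.9) pp.390–392).
-/

set_option autoImplicit false

noncomputable section

open scoped BigOperators Matrix.Norms.L2Operator
open NormedSpace

namespace Summit.QuantumFields.YangMills.Theorems.Prop7PinnedRegaugeChartDivergence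

open Literature.MathematicalPhysics.QuantumFieldTheory.Balaban1983to89
open MatrixLog (mlog)
open B9Eq39Adjoint (R R_def R_add R_sub R_mul_R covD covDstar divB)
open ExpMeanLog (mlog_conj)
open Summit.QuantumFields.YangMills.Theorems.Prop7HolRatioPerStep (coe_star_mul_self coe_mul_star_self norm_coe_eq_one norm_star_coe_eq_one)
open Summit.QuantumFields.YangMills.Theorems.Prop7CovIterLambdaBound (norm_conj_su_le)
open Summit.QuantumFields.YangMills.Theorems.Prop7PinnedRegaugeChartDiagonal (norm_chartRemainderDiag_sub_le)

variable {n : Type*} [Fintype n] [DecidableEq n] [Nonempty n]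

/-! ## §1 Conjugation equivariance of `Φ♯` -/

section Equivariance

omit [Nonempty n] in
/-- **`Φ♯` is conjugation-equivariant**: for every unit `g` of `M_N(ℂ)`,
`Φ♯(R(g)u, R(g)E, R(g)δ) = R(g)·Φ♯(u, E, δ)`, `Φ♯(u,E,δ) = log(u·E·e^{−log u+δ}) − (log E + δ)`
(`log` and `exp` commute with conjugation: ✓ `ExpMeanLog.mlog_conj`, `Matrix.exp_units_conj`). [folklore] [cite: Balaban1985BackgroundPropagators, p.390] -/
theorem chartRemainderDiag_R (g : (Matrix n n ℂ)ˣ) (u E δ : Matrix n n ℂ) :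
    mlog (R g u * R g E * exp (-mlog (R g u) + R g δ)) - (mlog (R g E) + R g δ)
      = R g (mlog (u * E * exp (-mlog u + δ)) - (mlog E + δ)) := by
  have hg1 : (g : Matrix n n ℂ) * ((g⁻¹ : (Matrix n n ℂ)ˣ) : Matrix n n ℂ) = 1 := Units.mul_inv g
  have hg2 : ((g⁻¹ : (Matrix n n ℂ)ˣ) : Matrix n n ℂ) * (g : Matrix n n ℂ) = 1 := Units.inv_mul g
  have hml : ∀ X : Matrix n n ℂ, mlog (R g X) = R g (mlog X) := fun X => by
    rw [R_def, R_def]; exact mlog_conj hg1 hg2 X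
  have hexp : ∀ X : Matrix n n ℂ, exp (R g X) = R g (exp X) := fun X => by
    rw [R_def, R_def]; exact Matrix.exp_units_conj g X
  have e1 : -mlog (R g u) + R g δ = R g (-mlog u + δ) := by
    rw [hml u, neg_add_eq_sub, neg_add_eq_sub, R_sub]
  rw [e1, hexp, R_mul_R, R_mul_R, hml, hml E, ← R_add, ← R_sub]

end Equivariance

/-! ## §2 The background read in the units; the corrector's letters -/

section Letters

variable {S : Type*} {ι : Type*} (T : ι → Equiv.Perm S) (U : ι → S → (Matrix n n ℂ)ˣ)
  (W : ι → S → Matrix.specialUnitaryGroup n ℂ)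

omit [Nonempty n] in
/-- If the units background `U` has the `SU(N)` values `W`, its inverses are the adjoints: `↑(U_μ(x))⁻¹ = W_μ(x)*`. [folklore] -/
theorem coe_inv_eq_star (hUW : ∀ μ x, (U μ x : Matrix n n ℂ) = (W μ x : Matrix n n ℂ)) (μ : ι) (x : S) :
    (((U μ x)⁻¹ : (Matrix n n ℂ)ˣ) : Matrix n n ℂ) = star (W μ x : Matrix n n ℂ) :=
  Units.inv_eq_of_mul_eq_one_right (by rw [hUW, coe_mul_star_self])

omit [Nonempty n] in
/-- The reversed-bond transport is conjugation by `W*`: `R(U_μ(y))⁻¹X = W_μ(y)*·X·W_μ(y)`. [folklore]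
[cite: Balaban1985BackgroundPropagators, (3.5) p.391] -/
theorem R_inv_eq_star_mul (hUW : ∀ μ x, (U μ x : Matrix n n ℂ) = (W μ x : Matrix n n ℂ)) (μ : ι) (y : S) (X : Matrix n n ℂ) :
    R (U μ y)⁻¹ X = star (W μ y : Matrix n n ℂ) * X * (W μ y : Matrix n n ℂ) := by
  rw [R_def, inv_inv, coe_inv_eq_star U W hUW, hUW]

omit [Nonempty n] in
/-- **The covariant-difference letter is `−D_{U,μ}(log u)`**: `log u(x) − W_μ(x)(log u(x+e_μ))W_μ(x)* = −(D_{U,μ}(log ∘ u))(x)`.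
[cite: Balaban1985BackgroundPropagators, (3.3) p.390] -/
theorem neg_covD_mlog_eq (hUW : ∀ μ x, (U μ x : Matrix n n ℂ) = (W μ x : Matrix n n ℂ)) (u : S → Matrix.specialUnitaryGroup n ℂ)
    (μ : ι) (x : S) :
    mlog (u x : Matrix n n ℂ) - (W μ x : Matrix n n ℂ) * mlog (u (T μ x) : Matrix n n ℂ) * star (W μ x : Matrix n n ℂ)
      = -covD T U μ (fun z => mlog (u z : Matrix n n ℂ)) x := by
  simp only [covD, R_def, coe_inv_eq_star U W hUW, hUW]
  abel

omit [Nonempty n] in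
/-- The transported corrector is again in `SU(N)`: with `u′ := W_μ(y)*·u(y)·W_μ(y)` (product in the group),
`↑u′ = R(U_μ(y))⁻¹ u(y)`, so `↑u′ − u(x) = (D*_μ u)(x)` for `y = x − e_μ`. [folklore] [cite: Balaban1985BackgroundPropagators, (3.8) p.392] -/
theorem covDstar_coe_eq (hUW : ∀ μ x, (U μ x : Matrix n n ℂ) = (W μ x : Matrix n n ℂ)) (u : S → Matrix.specialUnitaryGroup n ℂ)
    (μ : ι) (x : S) :
    covDstar T U μ (fun z => (u z : Matrix n n ℂ)) x
      = ((star (W μ ((T μ).symm x)) * u ((T μ).symm x) * W μ ((T μ).symm x) : Matrix.specialUnitaryGroup n ℂ) : Matrix n n ℂ)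
        - (u x : Matrix n n ℂ) := by
  simp only [covDstar, R_inv_eq_star_mul U W hUW]
  rfl

end Letters

/-! ## §3 The pointwise divergence row -/

section Pointwise

variable {S : Type*} {ι : Type*} [Fintype ι] (T : ι → Equiv.Perm S) (U : ι → S → (Matrix n n ℂ)ˣ)
  (W : ι → S → Matrix.specialUnitaryGroup n ℂ)

/-- ★★★ **THE POINTWISE DIVERGENCE ROW OF (P-bch).**  With `R₂(μ, x) := Φ♯(u(x), E_μ(x), δ_μ(x))` displayed, under the sup rows
`‖u(x) − 1‖ ≤ σ`, `‖E_μ(x) − 1‖ ≤ τ`, `‖δ_μ(x)‖ ≤ ρ` (`σ, τ, ρ ≤ 1∕256`):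
`‖(D* R₂)(x)‖ ≤ Σ_μ [20(τ+ρ)·‖(D*_μ u)(x)‖ + 50(σ+ρ)·‖(D*_μ E_μ)(x)‖ + 10(σ+τ)·‖(D*_μ δ_μ)(x)‖]`.
Proof: `D*_μ R₂,μ (x) = R(U)⁻¹Φ♯(a(y)) − Φ♯(a(x)) = Φ♯(R(U)⁻¹a(y)) − Φ♯(a(x))` (§1), the transported data obey the same sup rows (conjugation
by `W* ∈ SU(N)` is an isometry fixing `1`), and ✓ C¹-Φ♯. [cite: Balaban1985Variational, (141)-(143) p.299] [cite: Balaban1985BackgroundPropagators, (3.8) p.392] -/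
theorem norm_divB_chartRemainder_le (hUW : ∀ μ x, (U μ x : Matrix n n ℂ) = (W μ x : Matrix n n ℂ))
    (u : S → Matrix.specialUnitaryGroup n ℂ) (E δ : ι → S → Matrix n n ℂ) {σ τ ρ : ℝ}
    (hσ : σ ≤ 1 / 256) (hτ : τ ≤ 1 / 256) (hρ : ρ ≤ 1 / 256)
    (hu : ∀ x, ‖(u x : Matrix n n ℂ) - 1‖ ≤ σ) (hE : ∀ μ x, ‖E μ x - 1‖ ≤ τ) (hδ : ∀ μ x, ‖δ μ x‖ ≤ ρ) (x : S) :
    ‖divB T U (fun μ y => mlog ((u y : Matrix n n ℂ) * E μ y * exp (-mlog (u y : Matrix n n ℂ) + δ μ y)) - (mlog (E μ y) + δ μ y)) x‖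
      ≤ ∑ μ, (20 * (τ + ρ) * ‖covDstar T U μ (fun y => (u y : Matrix n n ℂ)) x‖
              + 50 * (σ + ρ) * ‖covDstar T U μ (E μ) x‖ + 10 * (σ + τ) * ‖covDstar T U μ (δ μ) x‖) := by
  unfold divB
  refine (norm_sum_le _ _).trans (Finset.sum_le_sum fun μ _ => ?_)
  -- the transported data at `y = x − e_μ`
  set y := (T μ).symm x with hy
  set g : Matrix.specialUnitaryGroup n ℂ := star (W μ y) with hg
  have hcg : (g : Matrix n n ℂ) = star (W μ y : Matrix n n ℂ) := rfl
  have hRg : ∀ X : Matrix n n ℂ, R (U μ y)⁻¹ X = (g : Matrix n n ℂ) * X * star (g : Matrix n n ℂ) := fun X => by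
    rw [R_inv_eq_star_mul U W hUW, hcg, star_star]
  -- `u′ := g·u(y)·g*` in the group
  have hcu : ((g * u y * star g : Matrix.specialUnitaryGroup n ℂ) : Matrix n n ℂ) = (g : Matrix n n ℂ) * (u y : Matrix n n ℂ) * star (g : Matrix n n ℂ) := rfl
  -- the `μ`-th term of the divergence, rewritten through §1
  have hterm : covDstar T U μ (fun z => mlog ((u z : Matrix n n ℂ) * E μ z * exp (-mlog (u z : Matrix n n ℂ) + δ μ z)) - (mlog (E μ z) + δ μ z)) x
      = (mlog (((g * u y * star g : Matrix.specialUnitaryGroup n ℂ) : Matrix n n ℂ) * R (U μ y)⁻¹ (E μ y)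
            * exp (-mlog (((g * u y * star g : Matrix.specialUnitaryGroup n ℂ) : Matrix n n ℂ)) + R (U μ y)⁻¹ (δ μ y)))
            - (mlog (R (U μ y)⁻¹ (E μ y)) + R (U μ y)⁻¹ (δ μ y)))
        - (mlog ((u x : Matrix n n ℂ) * E μ x * exp (-mlog (u x : Matrix n n ℂ) + δ μ x)) - (mlog (E μ x) + δ μ x)) := by
    simp only [covDstar]
    rw [← hy, ← chartRemainderDiag_R (U μ y)⁻¹, hcu, hRg]
  rw [hterm]
  -- sup rows of the transported data
  have hu' : ‖((g * u y * star g : Matrix.specialUnitaryGroup n ℂ) : Matrix n n ℂ) - 1‖ ≤ σ := by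
    rw [hcu, show (g : Matrix n n ℂ) * (u y : Matrix n n ℂ) * star (g : Matrix n n ℂ) - 1
        = (g : Matrix n n ℂ) * ((u y : Matrix n n ℂ) - 1) * star (g : Matrix n n ℂ) by rw [mul_sub, sub_mul, mul_one, coe_mul_star_self]]
    exact (norm_conj_su_le g _).trans (hu y)
  have hE' : ‖R (U μ y)⁻¹ (E μ y) - 1‖ ≤ τ := by
    rw [hRg, show (g : Matrix n n ℂ) * E μ y * star (g : Matrix n n ℂ) - 1
        = (g : Matrix n n ℂ) * (E μ y - 1) * star (g : Matrix n n ℂ) by rw [mul_sub, sub_mul, mul_one, coe_mul_star_self]]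
    exact (norm_conj_su_le g _).trans (hE μ y)
  have hδ' : ‖R (U μ y)⁻¹ (δ μ y)‖ ≤ ρ := by
    rw [hRg]; exact (norm_conj_su_le g _).trans (hδ μ y)
  -- C¹-Φ♯
  have h := norm_chartRemainderDiag_sub_le (g * u y * star g) (u x) (R (U μ y)⁻¹ (E μ y)) (E μ x) (R (U μ y)⁻¹ (δ μ y)) (δ μ x)
    hσ hτ hρ hu' (hu x) hE' (hE μ x) hδ' (hδ μ x)
  -- the slot differences are the covariant differences at `x`
  have d0 : ((g * u y * star g : Matrix.specialUnitaryGroup n ℂ) : Matrix n n ℂ) - (u x : Matrix n n ℂ) = covDstar T U μ (fun z => (u z : Matrix n n ℂ)) x := by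
    simp only [covDstar]; rw [← hy, hRg, hcu]
  have d1 : R (U μ y)⁻¹ (E μ y) - E μ x = covDstar T U μ (E μ) x := by
    simp only [covDstar]; rw [← hy]
  have d2 : R (U μ y)⁻¹ (δ μ y) - δ μ x = covDstar T U μ (δ μ) x := by
    simp only [covDstar]; rw [← hy]
  rw [d0, d1, d2] at h
  exact h

end Pointwise

/-! ## §4 The ℓ² divergence row (operator norm) -/

section SquareSum

variable {S : Type*} [Fintype S] {ι : Type*} [Fintype ι] (T : ι → Equiv.Perm S) (U : ι → S → (Matrix n n ℂ)ˣ)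
  (W : ι → S → Matrix.specialUnitaryGroup n ℂ)

omit [Fintype n] [DecidableEq n] [Nonempty n] in
/-- arithmetic: `(Σ_μ t_μ)² ≤ |ι|·Σ_μ t_μ²` (Cauchy–Schwarz). [folklore] -/
theorem sq_sum_univ_le_card_mul (t : ι → ℝ) : (∑ μ, t μ) ^ 2 ≤ Fintype.card ι * ∑ μ, t μ ^ 2 := by
  have h := _root_.sq_sum_le_card_mul_sum_sq (s := (Finset.univ : Finset ι)) (f := t)
  simpa [Finset.card_univ] using h

/-- ★★ **THE ℓ² DIVERGENCE ROW OF (P-bch) (operator norm).**  Under the sup rows of `norm_divB_chartRemainder_le`: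
`Σ_x ‖(D* R₂)(x)‖² ≤ 3·|ι|·Σ_x Σ_μ [(20(τ+ρ))²·‖(D*_μ u)(x)‖² + (50(σ+ρ))²·‖(D*_μ E_μ)(x)‖² + (10(σ+τ))²·‖(D*_μ δ_μ)(x)‖²]`.
(The HS re-lettering, the re-indexing `D*_μ ↔ D_μ` and the Weitzenböck bookings of the three right-hand energies are downstream.)
[cite: Balaban1985Variational, (135) p.298, (141)-(143) p.299] [cite: Balaban1985BackgroundPropagators, (3.8) p.392] -/
theorem sum_norm_divB_chartRemainder_sq_le (hUW : ∀ μ x, (U μ x : Matrix n n ℂ) = (W μ x : Matrix n n ℂ))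
    (u : S → Matrix.specialUnitaryGroup n ℂ) (E δ : ι → S → Matrix n n ℂ) {σ τ ρ : ℝ}
    (hσ : σ ≤ 1 / 256) (hτ : τ ≤ 1 / 256) (hρ : ρ ≤ 1 / 256)
    (hu : ∀ x, ‖(u x : Matrix n n ℂ) - 1‖ ≤ σ) (hE : ∀ μ x, ‖E μ x - 1‖ ≤ τ) (hδ : ∀ μ x, ‖δ μ x‖ ≤ ρ) :
    ∑ x, ‖divB T U (fun μ y => mlog ((u y : Matrix n n ℂ) * E μ y * exp (-mlog (u y : Matrix n n ℂ) + δ μ y)) - (mlog (E μ y) + δ μ y)) x‖ ^ 2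
      ≤ 3 * Fintype.card ι * ∑ x, ∑ μ, ((20 * (τ + ρ)) ^ 2 * ‖covDstar T U μ (fun y => (u y : Matrix n n ℂ)) x‖ ^ 2
              + (50 * (σ + ρ)) ^ 2 * ‖covDstar T U μ (E μ) x‖ ^ 2 + (10 * (σ + τ)) ^ 2 * ‖covDstar T U μ (δ μ) x‖ ^ 2) := by
  rw [Finset.mul_sum]
  refine Finset.sum_le_sum fun x _ => ?_
  have hpt := norm_divB_chartRemainder_le T U W hUW u E δ hσ hτ hρ hu hE hδ x
  have h0 : 0 ≤ ‖divB T U (fun μ y => mlog ((u y : Matrix n n ℂ) * E μ y * exp (-mlog (u y : Matrix n n ℂ) + δ μ y)) - (mlog (E μ y) + δ μ y)) x‖ :=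
    norm_nonneg _
  -- square the pointwise row, then Cauchy–Schwarz over `μ`, then `(a+b+c)² ≤ 3(a²+b²+c²)`
  have h1 := pow_le_pow_left₀ h0 hpt 2
  have h2 := sq_sum_univ_le_card_mul (ι := ι) (fun μ => 20 * (τ + ρ) * ‖covDstar T U μ (fun y => (u y : Matrix n n ℂ)) x‖
              + 50 * (σ + ρ) * ‖covDstar T U μ (E μ) x‖ + 10 * (σ + τ) * ‖covDstar T U μ (δ μ) x‖)
  have h3 : ∑ μ, (20 * (τ + ρ) * ‖covDstar T U μ (fun y => (u y : Matrix n n ℂ)) x‖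
              + 50 * (σ + ρ) * ‖covDstar T U μ (E μ) x‖ + 10 * (σ + τ) * ‖covDstar T U μ (δ μ) x‖) ^ 2
      ≤ ∑ μ, 3 * ((20 * (τ + ρ)) ^ 2 * ‖covDstar T U μ (fun y => (u y : Matrix n n ℂ)) x‖ ^ 2
              + (50 * (σ + ρ)) ^ 2 * ‖covDstar T U μ (E μ) x‖ ^ 2 + (10 * (σ + τ)) ^ 2 * ‖covDstar T U μ (δ μ) x‖ ^ 2) := by
    refine Finset.sum_le_sum fun μ _ => ?_
    -- `(a + b + c)² ≤ 3(a² + b² + c²)`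
    have h : ∀ a b c : ℝ, (a + b + c) ^ 2 ≤ 3 * (a ^ 2 + b ^ 2 + c ^ 2) := fun a b c => by
      nlinarith [sq_nonneg (a - b), sq_nonneg (b - c), sq_nonneg (a - c)]
    have h' := h (20 * (τ + ρ) * ‖covDstar T U μ (fun y => (u y : Matrix n n ℂ)) x‖)
      (50 * (σ + ρ) * ‖covDstar T U μ (E μ) x‖) (10 * (σ + τ) * ‖covDstar T U μ (δ μ) x‖)
    simpa only [mul_pow, mul_add] using h'
  have hcard : (0 : ℝ) ≤ Fintype.card ι := Nat.cast_nonneg _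
  calc ‖divB T U (fun μ y => mlog ((u y : Matrix n n ℂ) * E μ y * exp (-mlog (u y : Matrix n n ℂ) + δ μ y)) - (mlog (E μ y) + δ μ y)) x‖ ^ 2
      ≤ (∑ μ, (20 * (τ + ρ) * ‖covDstar T U μ (fun y => (u y : Matrix n n ℂ)) x‖
              + 50 * (σ + ρ) * ‖covDstar T U μ (E μ) x‖ + 10 * (σ + τ) * ‖covDstar T U μ (δ μ) x‖)) ^ 2 := h1
    _ ≤ Fintype.card ι * ∑ μ, (20 * (τ + ρ) * ‖covDstar T U μ (fun y => (u y : Matrix n n ℂ)) x‖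
              + 50 * (σ + ρ) * ‖covDstar T U μ (E μ) x‖ + 10 * (σ + τ) * ‖covDstar T U μ (δ μ) x‖) ^ 2 := h2
    _ ≤ Fintype.card ι * ∑ μ, 3 * ((20 * (τ + ρ)) ^ 2 * ‖covDstar T U μ (fun y => (u y : Matrix n n ℂ)) x‖ ^ 2
              + (50 * (σ + ρ)) ^ 2 * ‖covDstar T U μ (E μ) x‖ ^ 2 + (10 * (σ + τ)) ^ 2 * ‖covDstar T U μ (δ μ) x‖ ^ 2) :=
          mul_le_mul_of_nonneg_left h3 hcard
    _ = 3 * Fintype.card ι * ∑ μ, ((20 * (τ + ρ)) ^ 2 * ‖covDstar T U μ (fun y => (u y : Matrix n n ℂ)) x‖ ^ 2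
              + (50 * (σ + ρ)) ^ 2 * ‖covDstar T U μ (E μ) x‖ ^ 2 + (10 * (σ + τ)) ^ 2 * ‖covDstar T U μ (δ μ) x‖ ^ 2) := by
          rw [← Finset.mul_sum]; ring

end SquareSum

end Summit.QuantumFields.YangMills.Theorems.Prop7PinnedRegaugeChartDivergence

end
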